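import Literature.MathematicalPhysics.QuantumFieldTheory.Balaban1983to89.B8Ineq159MultiLevelTorusL0
import Literature.MathematicalPhysics.QuantumFieldTheory.Balaban1983to89.B6GOmegaMarginV1
import Literature.MathematicalPhysics.QuantumFieldTheory.Balaban1983to89.B6QppKernelV1
import Literature.MathematicalPhysics.QuantumFieldTheory.Balaban1983to89.B8
import Literature.MathematicalPhysics.QuantumFieldTheory.Balaban1983to89.B6Geom246MultiLevelBoxL0
import Literature.MathematicalPhysics.QuantumFieldTheory.Balaban1983to89.B6Geom246MultiLevelTorusL0
import Literature.MathematicalPhysics.QuantumFieldTheory.Balaban1983to89.B6GlobalChartV1L0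
import Literature.MathematicalPhysics.QuantumFieldTheory.Balaban1983to89.B6MultiLevelTorusOperatorL0
import Literature.MathematicalPhysics.QuantumFieldTheory.Balaban1983to89.B8Ineq192MultiLevelTorusL0
import Literature.MathematicalPhysics.QuantumFieldTheory.Balaban1983to89.B8Prop3MultiLevelTorus

/-!
# `Balaban1983to89.B8Prop3MultiLevelTorusL0` — LEVEL-0 TWIN (programme G-F3′-L0, director-ym LINE №27 / UV3-NODE §24.5; plan `lit-balaban-r03/G-F3L0-PLAN.md`) of `B8Prop3MultiLevelTorus`:
the same declarations, SAME NAMES AND STATEMENTS, for nested families WITH print's region `Λ₀ = T ∖ Ω₁` ADMITTED (structures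
`B6MultiLevelBoxOperatorL0.Domains` / `B6MultiLevelTorusOperatorL0.TDomains`: levels `0, …, k`, the level-`0` block a single site, `Q′₀ = id`,
finite weight `a₀` — print p.225 (2.14) «Σ_{j=0}^k … (Q′₀λ)(x) = λ(x), x ∈ Λ₀», p.229 «taking a sequence (2.1) … smallest possible domains B^j(Λ_j),
and considering the operator Δ_a defined by (2.19), (2.20) for this sequence»).  Every `D`-free object is the lineage's, consumed BY NAME; no existing
module is touched; no fact is minted.  Sub-row G-F3′-L0∕B8 («N05 cone», ME #33; `lit-balaban-lead/ROW-G-F3p-L0.md` §7): unit `lit-balaban-r05`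
(B8 fold owner, r05 gen 76), port discipline of `lit-balaban-r03` (port.py → reduce.py → by-name imports → dedup); referee ref-4.  THE TWIN'S DOCUMENTATION
FOLLOWS VERBATIM (its «levels 1 … k» / «Ω₁ = X» sentences describe the twin; here `j` runs from `0` and `Ω₁` may be a proper subset).

# `Balaban1983to89.B8Prop3MultiLevelTorus` — T. Bałaban, *Spaces of regular gauge field configurations on a lattice and gauge fixing
# conditions*, Commun. Math. Phys. **99** (1985) 75–102 [Balaban1985RegularSpaces], **(1.58)–(1.59) p. 86, THE SIZE OF THE SECOND SUMMAND
# OF (1.58) «G(U₀)Σ_jQ*_jΛ_j(Lʲη)⁻³B₁» — `|Σ_jQ*_jΛ_j(Lʲη)⁻³B₁|₍₋₃₎ ≦ O(1)|B₁|`, the step print uses silently between (1.58) and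
# «≦ B₀(|J|₍₋₃₎ + |B₁|)» of (1.59) — AT U₀ = 1 ON THE `k`-LEVEL TORUS, VECTOR SIDE, for the GENUINE iterated vector averages `Q_j` (1.18)
# of the V1 multi-level calculus: `k`-level block locality and column mass of `Q_j`, the level coverage of a fine bond by the `Λ_j`-bonds of
# the nested family, and the resulting weighted bound; + (1.59) in print's shape «≦ B₀(|J|₍₋₃₎ + |B₁|)» for the `|A|₍₋₁₎` member of THE
# genuine `k`-level `G(1)`, modulo its (2.136)₁ majorant; + **PROPOSITION 3 p. 87 AT U₀ = 1 ON THE `k`-LEVEL TORUS** ((1.59) ⟹ (1.60) ⟹ (1.62),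
# `B₁ = 5dLB₀′`) for the genuine `G(1) = Δ_a⁻¹`, MODULO the three (2.136) majorants of `G(1)`, `∇G(1)`, `ΔG(1)` (as arguments)

statement-level skeleton of published theorems with citation tags; proofs where landed; nothing here is a claim about the Yang–Mills mass gap

PDF held: `paper:balaban1985-cmp99-regular-spaces-gauge-fixing` (journal page = PDF page + 74); p. 86 [PDF 12] re-read this generation (text layer
p0012.txt: «hence LʲηQ_jA = B₁, B₁ = B − C_j(LʲηA) on Λ_j, |B₁| < 2dLα₁ + C₂α₂²», (1.58), (1.59), «let us assume that B₀36dα₂ ≦ ½», (1.60), (1.61);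
p. 87 [PDF 13] p0013.txt: (1.62), Proposition 3); [B5] = T. Bałaban, *Propagators and
renormalization transformations for lattice gauge theories. I*, Commun. Math. Phys. **95** (1984) 17–40 [Balaban1984PropagatorsI] pp. 19–20
((1.8), (1.11), (1.18)) through the verbatim quotations of the tree modules `LatticeFieldCalculus` / `B5Eq118OneStroke` / `B5AveragingLocalityV1`;
[B6] = T. Bałaban, *Propagators and renormalization transformations for lattice gauge theories. II*, Commun. Math. Phys. **96** (1984) 223–250
[Balaban1984PropagatorsII] pp. 224–226 ((2.3), (2.18)–(2.20)) through `B6SectADomainsV1` / `B6SectAOperatorsV1`.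

CITATION HEADER (lean-in-tree rule).  Cell `lit-balaban` (HOME `run/shared/lean/pub/lit-balaban/`), unit `lit-balaban-r05` gen 61 (B8 reader/typer and
fold owner; B8-CLOSURE.md §5 item 2(iv), the announced successor of `B8Ineq159MultiLevelTorus` p352959).  WHAT IS REPRODUCED = SKELETON rows
**B8.Eq1.58** / **B8.Eq1.59** / **B8.Prop3** (cells; the insertion of (1.58)'s second summand into (1.59), and (1.59) ⟹ (1.62) for the genuine
`k`-level operator modulo the [B6] Prop. 2.6 majorants) as «kernel-checked proofs of a model instance» on p21's
V1 multi-level torus calculus (`B6SectAOperatorsV1`: `Q = QE`, `Q* = QsE` (the `ℓ²`-adjoint), `a = aE w`; `B6SectADomainsV1.Domains`, `LamBond` =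
(2.3) «at least one end-point in Ω_j, no end-point inside Ω_{j+1}») and, for the levels, r03's reading `B6GlobalChartV1L0.domT hN D hk` of p21's
torus family `D : TDomains` with the block map `blkV1`.  Theorems only; 0 `def`; every input BY NAME; 0 sorry; D-0026: no `… : Prop` fact.

WHAT IS PRINTED (verbatim).  B8 p. 86 [PDF 12]: *"hence LʲηQ_jA = B₁, B₁ = B − C_j(LʲηA) on Λ_j, |B₁| < 2dLα₁ + C₂α₂². … They imply finally
A = G(U₀)J − G(U₀)D^{η*}_{U₀}D_{U₀}H(U₀)B₁ + H(U₀)B₁ = G(U₀)J + G(U₀)Σ_jQ*_jΛ_j(Lʲη)⁻³B₁, (1.58) … Theorem 3.3 of [4] implies the bounds: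
|A|₍₋₁₎, |∇^η_{U₀}A|₍₋₂₎, |D^{η*}_{U₀}D^η_{U₀}A|₍₋₃₎, |Δ^η_{U₀}A|₍₋₃₎ ≦ B₀(|J|₍₋₃₎ + |B₁|) (1.59) … Let us take this bound for |∇^η_{U₀}A|₍₋₂₎ on
the left-hand side, and let us assume that B₀36dα₂ ≦ ½. … (1.60) Now we assume further that 2α₂² + 20dα₀α₂ + 2C₂α₂² ≦ α₀ + α₁. (1.61)"*;
p. 87 [PDF 13]: *"This and the previous inequality give finally |A| < 5dLB₀(α₀ + α₁)(Lʲη)⁻¹, |∇^η_{U₀}A| < 5dLB₀(α₀ + α₁)(Lʲη)⁻², … on Ω_j. (1.62)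
… Proposition 3. If U₀, U₁, U₂ satisfy (1.40)–(1.42) with α₀, α₁, α₂ bounded by a constant depending on d and L only, and α₂ satisfies the
additional restriction (1.61), then U₁ satisfies (1.36)–(1.39) with B₁ = 5dLB₀, B₂(β₀) = 5dLB₀(β₀), where B₀, B₀(β₀) are the corresponding
norms of the operators G(U₀), H(U₀), and depend on d and L only"*; p. 86: *"|A|₍α₎ = sup_j sup_{Ω_j}(Lʲη)^{−α}|A|"*.
[B5] p. 19: *"(QA)(c) = Σ_{x∈B(c₋)} L^{−(d+1)} A([x, x(c)]) … x(c) denotes a point in the block B(c₊) obtained by translation of x by the bond c"* ((1.11)),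
p. 20 (1.18) (the iterated `Q_k` over `B^k(b₋)`).  [B6] p. 224: *"Ω also the set of bonds ⋃_{x∈Ω} st(x) = {bonds b: at least one end-point of b
belongs to Ω}"*, (2.3) `Λ_j = Ω_j ∖ Ω_{j+1}`; p. 226 (2.20) *"(QA)(b) = (Q_jA)(b) for b ∈ Λ_j"*, (2.18) *"⟨Q*ω, A⟩"*.

THE INSTANCE AND THE MECHANISM (dictionary; the three facts print does not spell out).  In the tree's `ℓ²` normalisation (volume factor dropped,
`B6SectAOperatorsV1`) print's `Σ_jQ*_jΛ_j(Lʲη)⁻²Q_jA = Q*aQA` with `a = w`, `w_{(j,c)} = (Lʲη)⁻²·(Lʲ)^{d+1}` up to the window constants (the block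
volume `(Lʲ)^{d+1}` of the `(d+1)`-dimensional V1 torus replaces the weighted adjoint), and (1.56) `Q_jA = (Lʲη)⁻¹B₁` makes the second summand of
(1.58) `Q*a(QA) = Q*aB`, `B = (Lʲη)⁻¹B₁` on `Λ_j`.  Its size at a fine bond `b` of level `i` (lattice units `η = 1`):
(1) COLUMN MASS of the iterated average ([B5] (1.11)/(1.18): every fine bond lies on exactly `L` of the straight contours of each step):
`Σ_{c∈T^{(j)}} Q_j(c, b) = (L^{d+1})^{−j}`, entries `≥ 0` — so `|(Q*v)(b)| ≦ Σ_j (L^{d+1})^{−j}·sup{|v_{(j,c)}| : Q_j(c,b) ≠ 0}`;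
(2) `k`-LEVEL BLOCK LOCALITY ([B5] p. 19 «x(c) … in the block B(c₊)», iterated; p21's `B6GOmegaMarginV1.bondAvgIter_eq_zero_of_local`):
`Q_j(c, b) ≠ 0 ⟹ B^j(b₋) ∈ {c₋, c₊}`;
(3) LEVEL COVERAGE ((2.3): a `Λ_j`-bond has «no end-point inside Ω_{j+1}»): hence `b₋ ∉ Ω_{j+1}`, i.e. the level of `b` is `≤ j` — a fine bond of
level `i` is charged only by the levels `j ≥ i`, and `Σ_{j≥i}(L^{d+1})^{−j}·(Lʲ)^{d+1}(Lʲ)⁻³ ≦ (1 − L⁻³)⁻¹(Lⁱ)⁻³ ≦ 2(Lⁱ)⁻³`.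

WHAT THIS FILE PROVES (theorems only; imports `B8Ineq159MultiLevelTorus` (r05 g61: the operator form of (1.59), `eq158_line2_V1`, `len_blkV1`,
the `msup` dictionary), `B6GOmegaMarginV1` (p21: the `k`-level block locality `bondAvgIter_eq_zero_of_local` of `Q_k` — if `X` vanishes on every
fine bond whose end-points have their `B^k`-blocks in `{c₋, c₊}` then `(Q_kX)(c) = 0`), `B6QppKernelV1` (the one-step mass `sum_bondAvg`), `B8`
(the kernel-checked a-priori algebra `B8.apriori_160` / `B8.apriori_162` of (1.59) ⟹ (1.60) ⟹ (1.62))).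
* §1 LATTICE CALCULUS OF THE ITERATED VECTOR AVERAGE `Q_k` (any V1 `Params`): `bondAvgIter_nonneg`, **`sum_bondAvgIter`** (`Σ_c (Q_kX)(c) = (L^{d})^{−k}·Σ_b X(b)`, `d` the dimension of the `Params`), `sum_bondAvgIter_single`,
  **`iterBlockOf_of_bondAvgIter_single_ne_zero`** (`Q_k(c, b) ≠ 0 ⟹ B^k(b₋) ∈ {c₋, c₊}`).
* §2 THE ADJOINT ON FUNCTIONS (any nested family `Dm : B6SectADomainsV1.Domains P`): **`QsE_apply_eq_sum`** (`(Q*v)(b) = Σ_{i∈𝔅} v_i·Q_{j(i)}(c(i), b)`),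
  **`abs_QsE_apply_le`** (`|(Q*v)(b)| ≦ Σ_{j≤k} g_j·(L^{d})^{−j}` whenever `|v_i| ≦ g_{j(i)}` on the `i = (j, c)` charging `b`).
* §3 ON r03's READING `domT hN D hk` OF p21's TORUS FAMILY: **`lev_le_of_bondAvgIter_single_ne_zero`** (coverage: `(j, c) ∈ 𝔅` charging the fine bond
  `b` ⟹ `lev(b₋) ≤ j`) and **`abs_QsE_aE_le`** — THE SIZE OF (1.58)'s SECOND SUMMAND: for weights `|w_{(j,c)}| ≦ a₁(Lʲ)^{d+1}(Lʲ)⁻²` and data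
  `|B_{(j,c)}| ≦ β(Lʲ)⁻¹` («LʲηQ_jA = B₁», `|B₁| ≦ β`): `|(Q*aB)(b)| ≦ 2a₁β·(L^{j(b)})⁻³` at every fine bond, i.e. «|Σ_jQ*_jΛ_j(Lʲη)⁻³B₁|₍₋₃₎ ≦ 2a₁|B₁|».
* §4 **`ineq159_A_member_printed_V1`** — (1.59) IN PRINT'S SHAPE FOR THE `|A|₍₋₁₎` MEMBER OF THE GENUINE `k`-LEVEL `G(1)`, modulo its (2.136)₁
  majorant (the slot of `B8Ineq159MultiLevelTorusL0.ineq159_A_member_V1`): from (1.55) `∂*∂A = J`, (1.42) `R∂*A = 0`, (1.56) `QA = B` with the sizes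
  `|J(b)| ≦ n_J(L^{j(b)})⁻³`, `|B| ≦ β(Lʲ)⁻¹`, `|w| ≦ a₁(Lʲ)^{d+1}(Lʲ)⁻²`: `|A(b)| ≦ B₀(1 + 2a₁)(L^{j(b)})⁻¹(n_J + β)` — «|A|₍₋₁₎ ≦ B₀′(|J|₍₋₃₎ + |B₁|)».
* §5 **`prop3_multiLevelTorus_V1`** — PROPOSITION 3 AT U₀ = 1 ON THE `k`-LEVEL V1 TORUS FOR THE GENUINE `G(1) = Δ_a⁻¹`, MODULO THE THREE (2.136)
  MAJORANTS: with `∇^η_{U₀}|_{U₀=1}`, `Δ^η_{U₀}|_{U₀=1}` kept as ARBITRARY linear maps `Dop ν`, `Lop` on the fine vector fields (exactly as the abstract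
  `B8.apriori_160` keeps them), IF `onFun G(1)`, `Dop ν ∘ onFun G(1)`, `Lop ∘ onFun G(1)` carry (2.136)-shape majorants with prefactors `(Lʲ)²`,
  `Lʲ`, `1` on `blkV1 hN D`, THEN (1.55) `∂*∂A = J`, (1.42) `R∂*A = 0`, (1.56) `QA = B`, `|J|₍₋₃₎ ≦ n_J`, `|B₁| ≦ n_B` and print's size lines
  (1.55) «n_J ≦ 2α₀ + 36dα₂|∇A|₍₋₂₎ + 50dα₂³ + 10dα₀α₂» (with `|∇A|₍₋₂₎` = the p. 86 norm `msup` of the family `(ν, b) ↦ (Dop ν A)(b)`), (1.56)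
  «n_B ≦ 2dLα₁ + C₂α₂²», «B₀′36dα₂ ≦ ½», `50dα₂ ≦ 1` and (1.61) give **`|A|₍₋₁₎, |∇A|₍₋₂₎, |D*DA|₍₋₃₎ (= n_J), |ΔA|₍₋₃₎ ≦ 5dLB₀′(α₀ + α₁)`**,
  `B₀′ = B₀(1 + 2a₁)` — (1.62) in print's norms (`B8ScaledSupNorm.msup`, `η = 1`) AND pointwise «on Ω_j» (`|A(b)| ≦ 5dLB₀′(α₀ + α₁)(L^{j(b)})⁻¹`,
  `(L^{j(b)})⁻²` for `Dop ν A`, `(L^{j(b)})⁻³` for `Lop A`), (1.59) by `B8Ineq159MultiLevelTorusL0.ineq159_multiLevelTorus_V1` + §3, (1.60)/(1.62) by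
  `B8.apriori_160` / `B8.apriori_162` BY NAME.

HONEST SCOPE / NOT CLAIMED.  (i) Lattice units `η = 1`, `Ω₁ = T_η`, levels `1 … k`, level of a bond = level of its initial point (r03's `blkV1`);
the window shape `|w| ≦ a₁(Lʲ)^{d+1}(Lʲ)⁻²` is the tree's normalisation of print's `a_j = (Lʲη)⁻²` (an ASSUMPTION on the weights handed to
`B6SectAVectorModelV1.GE`, matching the windows of r03's/p22's two-scale files up to their units; not derived here); `|B| ≦ β(Lʲ)⁻¹` is (1.56) read
with `|B₁| ≦ β`.  (ii) The constant `2` uses `L ≥ 2` (`L³ ≥ 8`); print's `O(1)` is absorbed in `B₀`, whence `B₀′ = B₀(1 + 2a₁)` in place of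
print's `B₀`.  (iii) §4/§5 are CONDITIONAL on the (2.136)-shape majorants, taken as ARGUMENTS: (2.136)₁ for `onFun (GE …)` is r03's ROUTE V
(`B6Prop26KLevelSkeletonV1`, members pending); the (2.136)₂,₄ majorants of `∇G(1)`, `ΔG(1)` are not begun on the B6 side, and `∇^η_{U₀}`, `Δ^η_{U₀}`
at `U₀ = 1` are NOT instantiated here (arbitrary `Dop`, `Lop` — as `B8.apriori_160` keeps `g = |∇A|₍₋₂₎` a free real; the flat V1 vector
Laplacian `∂*∂ + ∂∂* = dcsE ∘ dcE + dE ∘ dsE` of `B6SectAOperatorsV1` is not threaded).  (iv) Print's `d`, `L` in `5dLB₀` enter §5 as real parameters `d_P ≥ 0`, `L_P` with `d_PL_P ≥ 1` (any, e.g. `d + 1`, `ℓ + 1`),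
and the size lines (1.55)/(1.56)/(1.61)/«B₀36dα₂ ≦ ½» are HYPOTHESES on the numbers `n_J, n_B, α₀, α₁, α₂, C₂` — their derivation from
(1.40)–(1.42) ((1.49)–(1.56), rows B8.Eq1.49–1.56) is p40's `B8Prop3Concrete` matter on the ℤᵈ carriers and is not re-done on the V1 torus.
(v) (1.62) is obtained in print's norms and pointwise (via `B8Ineq159MultiLevelTorusL0.pointwise_of_msup_le_blk`); (1.36)–(1.39) for `U₁ = U₀exp(iηA)` (the non-abelian exponential reading of Prop. 3) is NOT touched.  (vi) Rows B8.Eq1.58 / B8.Eq1.59 / B8.Prop3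
cells only; no head moves (G.5-45).  NOT summit progress, NOT continuum, NOT Clay.

RELATED IN THE TREE, NOT DUPLICATED (stem check 2026-08-23T05:25Z: `ls Balaban1983to89 | grep -i 'Prop3\|QstarMass'` = `B8Prop3Concrete`/`B8Prop3Holder`
(p40: Prop. 3 on the ℤᵈ carriers MODULO (1.59)), `B7Prop3*`, `B11Prop3*` (other papers); the one-level twin of §3 is
`B8Ineq159FlatTorus.norm_QvAdj_mulVec_le` (rows of `η^{−d}Q_kᴴ` have mass 1)): `B6GOmegaMarginV1.bondAvgIter_eq_zero_of_local`,
`B6QppKernelV1.sum_bondAvg`, `B5Eq118OneStroke.iterBlockOf_succ`, `B6SectAOperatorsV1.{QE_apply, inner_QsE_left, inner_eq_sum, aE_apply}`,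
`B6GlobalChartV1.{domT, iterBlockOf_mem_domT_iff, blkV1, toBox}`, `B8Ineq159MultiLevelTorus.*`, `B8.apriori_160` / `B8.apriori_162` (p06/p40's
kernel-checked (1.59) ⟹ (1.60) ⟹ (1.62) algebra; its ℤᵈ-carrier consumers `B8Prop3Concrete` / `B8Prop3Holder` are the flat-carrier twins of §5)
(USED BY NAME).
-/

namespace Literature.MathematicalPhysics.QuantumFieldTheory.Balaban1983to89.B8Prop3MultiLevelTorusL0

open Finset
open scoped InnerProductSpace
open LatticeFieldCalculus (bondAvg bondAvgIter segSum runBond runSite)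
open B5Eq118OneStroke (iterBlockOf iterBlockOf_zero iterBlockOf_succ)
open B6GOmegaMarginV1 (bondAvgIter_eq_zero_of_local)
open B6QppKernelV1 (sum_bondAvg)
open B4Reflection242 (boxDom)
open B6MultiLevelBoxOperator (N0)
open B6MultiLevelTorusOperatorL0 (TDomains)
open B6Geom246MultiLevelBoxL0 (bset blkOf)
open B6Geom246MultiLevelTorusL0 (geomT)
open B6RandomWalk (HasMajorant)
open B6SectAOperatorsV1 (dE dsE dcE dcsE QE QsE aE RE BondIdx BondIdxSpace QE_apply inner_QsE_left inner_eq_sum aE_apply)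
open B6SectAVectorModelV1 (GE)
open BalabanImbrieJaffe1984to88.BIJ85AxialPropagator411 (BondSpace)
open B6Ineq2133TwoScaleV1 (onFun onFun_apply)
open B6GlobalChartV1 (PV toBox)
open B6GlobalChartV1L0 (blkV1 domT iterBlockOf_mem_domT_iff)
open B8Ineq192MultiLevelTorusL0 (lenT_pos lenT_eq)
open B8Ineq159MultiLevelTorusL0 (len_blkV1 ineq159_A_member_V1)
open Literature.MathematicalPhysics.QuantumFieldTheory.Balaban1983to89.B8Prop3MultiLevelTorus (bondAvg_nonneg bondAvgIter_nonneg sum_bondAvgIter sum_bondAvgIter_single bondAvgIter_single_nonneg iterBlockOf_of_bondAvgIter_single_ne_zero QsE_apply_eq_sum abs_QsE_apply_le PV_L PV_d)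

noncomputable section

/-! ## §1  Lattice calculus of the iterated vector average `Q_k` ([B5] (1.11), (1.18)): block locality, positivity, column mass, support -/

section QkCalculus

variable {P : Params}

-- `k`-LEVEL BLOCK LOCALITY OF `Q_k` (`Q_k(c, ·)` lives on the fine bonds with both end-point blocks in `{c₋, c₊}`) is p21's
-- `B6GOmegaMarginV1.bondAvgIter_eq_zero_of_local` ([B5] (1.18) iterated), USED BY NAME below.

end QkCalculus

/-! ## §2  The adjoint `Q*` on functions: matrix element and the column-mass bound ([B6] (2.18)/(2.20)) -/

section Adjoint

variable {P : Params} (Dm : B6SectADomainsV1.Domains P)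

end Adjoint

/-! ## §3  On r03's reading `domT` of p21's torus family: level coverage of a fine bond by the `Λ_j`-bonds, and the size of (1.58)'s second summand -/

section Coverage

variable {d ℓ : ℕ} {m K : ℕ} {hd : 1 ≤ d + 1} {hL : Odd (ℓ + 1) ∧ 1 < ℓ + 1} {Mh k R : ℕ} {P' : Fin (d + 1) → ℕ}

open Classical in
/-- **LEVEL COVERAGE** ((2.3): a `Λ_j`-bond has «no end-point inside Ω_{j+1}»): if `i = (j, c) ∈ 𝔅` charges the fine bond `b` (`Q_j(c, b) ≠ 0`), then
`B^j(b₋) ∈ {c₋, c₊}` is not inside `Ω_{j+1}`, so — `Ω_{j+1} = {lev ≥ j+1}` in p21's family (`iterBlockOf_mem_domT_iff`) — the level of `b₋` is `≤ j`.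
[cite: Balaban1984PropagatorsII, (2.3) p.224, (2.1) p.224; Balaban1984PropagatorsI, (1.18) p.20] -/
theorem lev_le_of_bondAvgIter_single_ne_zero (hN : ∀ μ, N0 ℓ Mh k P' μ = (PV d ℓ m K hd hL).sitesPerDir 0)
    (D : B6MultiLevelTorusOperatorL0.TDomains d ℓ Mh k P' R) (hk : k ≤ m + K) (i : BondIdx (domT hN D hk)) (b : PBond (PV d ℓ m K hd hL) 0)
    (hq : bondAvgIter (i.1.1 : ℕ) (Pi.single b (1 : ℝ)) i.1.2 ≠ 0) :
    D.lev (toBox hN b.src).1 ≤ (i.1.1 : ℕ) := by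
  have hjk : (i.1.1 : ℕ) ≤ k := Nat.lt_succ_iff.1 i.1.1.isLt
  have hsrc := iterBlockOf_of_bondAvgIter_single_ne_zero
    (show (i.1.1 : ℕ) ≤ (PV d ℓ m K hd hL).m + (PV d ℓ m K hd hL).K from le_trans hjk hk) hq
  obtain ⟨-, hns, hnt⟩ := i.2
  -- the `j`-block of `b₋` is `c₋` or `c₊`, neither of which is deep
  have hnd : ¬ (domT hN D hk).Deep (i.1.1 : ℕ) (iterBlockOf (i.1.1 : ℕ) b.src) := by
    rcases hsrc with h | h <;> rw [h]
    · exact hns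
    · exact hnt
  by_cases hj : (i.1.1 : ℕ) + 1 ≤ k
  · have hmem : ¬ iterBlockOf ((i.1.1 : ℕ) + 1) b.src ∈ (domT hN D hk).Om ((i.1.1 : ℕ) + 1) := by
      rw [iterBlockOf_succ]; exact hnd
    rw [iterBlockOf_mem_domT_iff hN D hk hj] at hmem
    omega
  · have := D.lev_le (toBox hN b.src).1
    omega

open Classical in
/-- **THE SIZE OF (1.58)'s SECOND SUMMAND** «G(U₀)Σ_jQ*_jΛ_j(Lʲη)⁻³B₁»'s source, AT U₀ = 1 ON THE `k`-LEVEL TORUS: in the tree's letters `Q*aB`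
with weights `|w_{(j,c)}| ≦ a₁(Lʲ)^{d+1}(Lʲ)⁻²` (print's `a_j = (Lʲη)⁻²` times the block volume of the `ℓ²` normalisation) and data
`|B_{(j,c)}| ≦ β(Lʲ)⁻¹` ((1.56) «LʲηQ_jA = B₁» with `|B₁| ≦ β`), at every fine bond `b`: `|(Q*aB)(b)| ≦ 2a₁β·(L^{j(b)})⁻³` — i.e.
«|Σ_jQ*_jΛ_j(Lʲη)⁻³B₁|₍₋₃₎ ≦ 2a₁|B₁|», the insertion print makes between (1.58) and (1.59).  Mechanism: column mass (§1–§2) + level coverage +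
the geometric sum `Σ_{j ≥ i}L^{−3j} ≦ (1 − L⁻³)⁻¹L^{−3i} ≦ 2L^{−3i}` (`L ≥ 2`).
[cite: Balaban1985RegularSpaces, (1.58)–(1.59) p.86, (1.56) p.86; Balaban1984PropagatorsII, (2.3) p.224, (2.18)–(2.20) p.226; Balaban1984PropagatorsI, (1.18) p.20] -/
theorem abs_QsE_aE_le (hN : ∀ μ, N0 ℓ Mh k P' μ = (PV d ℓ m K hd hL).sitesPerDir 0) (D : B6MultiLevelTorusOperatorL0.TDomains d ℓ Mh k P' R) (hk : k ≤ m + K)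
    {a₁ β : ℝ} (ha₁ : 0 ≤ a₁) (hβ : 0 ≤ β) (w : BondIdx (domT hN D hk) → ℝ) (B : BondIdxSpace (domT hN D hk))
    (hw : ∀ i, |w i| ≤ a₁ * (((ℓ : ℝ) + 1) ^ (d + 1)) ^ (i.1.1 : ℕ) * ((((ℓ : ℝ) + 1) ^ (i.1.1 : ℕ)) ^ 2)⁻¹)
    (hB : ∀ i, |B i| ≤ β * (((ℓ : ℝ) + 1) ^ (i.1.1 : ℕ))⁻¹) (b : PBond (PV d ℓ m K hd hL) 0) :
    |(QsE (domT hN D hk) (aE (domT hN D hk) w B)) b| ≤ 2 * a₁ * β * ((geomT D).len (blkV1 hN D b) ^ 3)⁻¹ := by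
  have hL0 : (0 : ℝ) < (ℓ : ℝ) + 1 := by positivity
  have hL2 : (2 : ℝ) ≤ (ℓ : ℝ) + 1 := by
    have := hL.2
    have h1 : (1 : ℝ) ≤ (ℓ : ℝ) := by exact_mod_cast (by omega : 1 ≤ ℓ)
    linarith
  set lv : ℕ := D.lev (toBox hN b.src).1 with hlv
  -- the level of `b` in the length of its block
  have hlen : (geomT D).len (blkV1 hN D b) = ((ℓ : ℝ) + 1) ^ lv := len_blkV1 hN D b
  -- the charging profile
  set r : ℝ := ((((ℓ : ℝ) + 1) ^ 3))⁻¹ with hr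
  have hr0 : 0 ≤ r := by rw [hr]; positivity
  have hr8 : r ≤ 1 / 8 := by
    rw [hr, inv_eq_one_div]
    have h8 : (8 : ℝ) ≤ ((ℓ : ℝ) + 1) ^ 3 := by
      have := pow_le_pow_left₀ (by norm_num : (0 : ℝ) ≤ 2) hL2 3
      norm_num at this
      exact this
    exact one_div_le_one_div_of_le (by norm_num) h8
  -- `((Lʲ)³)⁻¹ = r^j`
  have hrj : ∀ j : ℕ, ((((ℓ : ℝ) + 1) ^ j) ^ 3)⁻¹ = r ^ j := fun j => by
    rw [hr, inv_pow, pow_right_comm]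
  have hr1 : r < 1 := by linarith
  set g : ℕ → ℝ := fun j => if lv ≤ j then a₁ * β * (((ℓ : ℝ) + 1) ^ (d + 1)) ^ j * r ^ j else 0 with hgdef
  have hg0 : ∀ j, 0 ≤ g j := fun j => by
    simp only [hgdef]
    split_ifs
    · positivity
    · exact le_rfl
  -- the hypothesis of the column-mass bound: on the charging `(j, c)`, `|w B| ≤ g j`
  have hv : ∀ i : BondIdx (domT hN D hk), bondAvgIter (i.1.1 : ℕ) (Pi.single b (1 : ℝ)) i.1.2 ≠ 0 →
      |aE (domT hN D hk) w B i| ≤ g i.1.1 := by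
    intro i hq
    have hcov : lv ≤ (i.1.1 : ℕ) := lev_le_of_bondAvgIter_single_ne_zero hN D hk i b hq
    rw [aE_apply, abs_mul]
    simp only [hgdef]
    rw [if_pos hcov]
    have hLj : 0 < ((ℓ : ℝ) + 1) ^ (i.1.1 : ℕ) := pow_pos hL0 _
    have hLj0 : ((ℓ : ℝ) + 1) ^ (i.1.1 : ℕ) ≠ 0 := hLj.ne'
    calc |w i| * |B i| ≤ (a₁ * (((ℓ : ℝ) + 1) ^ (d + 1)) ^ (i.1.1 : ℕ) * ((((ℓ : ℝ) + 1) ^ (i.1.1 : ℕ)) ^ 2)⁻¹) *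
          (β * (((ℓ : ℝ) + 1) ^ (i.1.1 : ℕ))⁻¹) :=
          mul_le_mul (hw i) (hB i) (abs_nonneg _) (by positivity)
      _ = a₁ * β * (((ℓ : ℝ) + 1) ^ (d + 1)) ^ (i.1.1 : ℕ) * ((((ℓ : ℝ) + 1) ^ (i.1.1 : ℕ)) ^ 3)⁻¹ := by
          field_simp
      _ = a₁ * β * (((ℓ : ℝ) + 1) ^ (d + 1)) ^ (i.1.1 : ℕ) * r ^ (i.1.1 : ℕ) := by rw [hrj]
  have hmain := abs_QsE_apply_le (domT hN D hk) (aE (domT hN D hk) w B) b g hg0 hv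
  refine hmain.trans ?_
  -- evaluate the level sum: the volume cancels against the column mass, a geometric tail from `lv` on remains
  have hPL : (((PV d ℓ m K hd hL).L : ℝ) ^ (PV d ℓ m K hd hL).d)⁻¹ = ((((ℓ : ℝ) + 1) ^ (d + 1)))⁻¹ := by
    rw [PV_L, PV_d]
  have hterm : ∀ j ∈ Finset.range ((domT hN D hk).k + 1),
      g j * ((((PV d ℓ m K hd hL).L : ℝ) ^ (PV d ℓ m K hd hL).d)⁻¹) ^ j = if lv ≤ j then a₁ * β * r ^ j else 0 := by
    intro j _
    rw [hPL]
    simp only [hgdef]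
    split_ifs
    · have hv0 : (((ℓ : ℝ) + 1) ^ (d + 1)) ^ j ≠ 0 := by positivity
      calc a₁ * β * (((ℓ : ℝ) + 1) ^ (d + 1)) ^ j * r ^ j * ((((ℓ : ℝ) + 1) ^ (d + 1))⁻¹) ^ j
          = a₁ * β * r ^ j * ((((ℓ : ℝ) + 1) ^ (d + 1)) ^ j * ((((ℓ : ℝ) + 1) ^ (d + 1)) ^ j)⁻¹) := by
            rw [inv_pow]; ring
        _ = a₁ * β * r ^ j := by rw [mul_inv_cancel₀ hv0, mul_one]
    · rw [zero_mul]
  rw [Finset.sum_congr rfl hterm, ← Finset.sum_filter]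
  have hsub : (Finset.range ((domT hN D hk).k + 1)).filter (fun j => lv ≤ j) ⊆ Finset.Ico lv ((domT hN D hk).k + 1) := by
    intro j hj
    rw [Finset.mem_filter, Finset.mem_range] at hj
    rw [Finset.mem_Ico]
    exact ⟨hj.2, hj.1⟩
  have hgeom : ∑ j ∈ Finset.Ico lv ((domT hN D hk).k + 1), r ^ j ≤ r ^ lv / (1 - r) := geom_sum_Ico_le_of_lt_one hr0 hr1
  calc ∑ j ∈ (Finset.range ((domT hN D hk).k + 1)).filter (fun j => lv ≤ j), a₁ * β * r ^ j
      ≤ ∑ j ∈ Finset.Ico lv ((domT hN D hk).k + 1), a₁ * β * r ^ j :=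
        Finset.sum_le_sum_of_subset_of_nonneg hsub fun j _ _ => by positivity
    _ = a₁ * β * ∑ j ∈ Finset.Ico lv ((domT hN D hk).k + 1), r ^ j := by rw [Finset.mul_sum]
    _ ≤ a₁ * β * (r ^ lv / (1 - r)) := mul_le_mul_of_nonneg_left hgeom (by positivity)
    _ ≤ a₁ * β * (2 * r ^ lv) := by
        refine mul_le_mul_of_nonneg_left ?_ (by positivity)
        rw [div_le_iff₀ (by linarith)]
        nlinarith [pow_nonneg hr0 lv]
    _ = 2 * a₁ * β * ((geomT D).len (blkV1 hN D b) ^ 3)⁻¹ := by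
        rw [hlen, hrj]
        ring

end Coverage

/-! ## §4  (1.59) in print's shape for the `|A|₍₋₁₎` member of THE genuine `k`-level `G(1)`, modulo its (2.136)₁ majorant -/

section Printed

/-- **(1.59), THE `|A|₍₋₁₎` MEMBER IN PRINT'S SHAPE «|A|₍₋₁₎ ≦ B₀(|J|₍₋₃₎ + |B₁|)» FOR THE GENUINE `k`-LEVEL `G(1) = Δ_a⁻¹` OF THE V1 TORUS, MODULO
ITS (2.136)₁ MAJORANT** (the slot of `B8Ineq159MultiLevelTorusL0.ineq159_A_member_V1`, now with (1.58)'s second summand inserted by §3): for all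
`C, σ > 0` there are `B₀ > 0`, `N₁ ≥ 1` (functions of `d, ℓ, C, σ`) such that on every admissible torus datum, for every `c′ ≠ 0`, weights `w > 0`
in the window `|w_{(j,c)}| ≦ a₁(Lʲ)^{d+1}(Lʲ)⁻²` (`a₁ ≥ 0`), IF `onFun (GE (domT hN D hk) hc′ hw)` has the majorant `C(Lʲ)²e^{−σd_T}` on `blkV1 hN D`,
THEN every vector field `A` with (1.55) `∂*∂A = J`, (1.42) `R∂*A = 0`, (1.56) `QA = B`, `|J(b)| ≦ n_J(L^{j(b)})⁻³` («|J|₍₋₃₎ ≦ n_J») and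
`|B_{(j,c)}| ≦ β(Lʲ)⁻¹` («|B₁| ≦ β») obeys `|A(b)| ≦ B₀(1 + 2a₁)·(n_J + β)·(L^{j(b)})⁻¹` at every fine bond — «|A|₍₋₁₎ ≦ B₀′(|J|₍₋₃₎ + |B₁|)».
[cite: Balaban1985RegularSpaces, (1.58)–(1.59) p.86, (1.55)–(1.56) p.86, Prop. 3 p.87; Balaban1985BackgroundPropagators, Theorem 3.3 p.399, (3.47) p.398; Balaban1984PropagatorsII, Prop. 2.6 (2.136) p.247, (2.19)–(2.20) p.226] -/
theorem ineq159_A_member_printed_V1 (d ℓ : ℕ) {C σ : ℝ} (hC : 0 < C) (hσ : 0 < σ) :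
    ∃ B₀ : ℝ, ∃ N₁ : ℕ, 0 < B₀ ∧ 0 < N₁ ∧
      ∀ (k Mh R : ℕ), 1 ≤ Mh → N₁ + 1 ≤ R * ((ℓ + 1) * Mh) →
      ∀ (P' : Fin (d + 1) → ℕ) (_hP : ∀ μ, 1 ≤ P' μ) (D : B6MultiLevelTorusOperatorL0.TDomains d ℓ Mh k P' R)
        (m K : ℕ) (hd : 1 ≤ d + 1) (hL : Odd (ℓ + 1) ∧ 1 < ℓ + 1)
        (hN : ∀ μ, N0 ℓ Mh k P' μ = (PV d ℓ m K hd hL).sitesPerDir 0) (hk : k ≤ m + K)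
        (cf : ℝ) (hcf : cf ≠ 0) (w : BondIdx (domT hN D hk) → ℝ) (hw : ∀ i, 0 < w i) (a₁ : ℝ) (_ha₁ : 0 ≤ a₁)
        (_hwin : ∀ i, |w i| ≤ a₁ * (((ℓ : ℝ) + 1) ^ (d + 1)) ^ (i.1.1 : ℕ) * ((((ℓ : ℝ) + 1) ^ (i.1.1 : ℕ)) ^ 2)⁻¹),
        HasMajorant (g := geomT D) (blkV1 hN D) (onFun (GE (domT hN D hk) hcf hw))
          (fun y y' => C * (geomT D).len y ^ 2 * Real.exp (-(σ * (geomT D).dist y y'))) →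
        ∀ (A J : BondSpace (PV d ℓ m K hd hL)) (B : BondIdxSpace (domT hN D hk)),
          dcsE cf (dcE cf A) = J → RE (domT hN D hk) cf (dsE cf A) = 0 → QE (domT hN D hk) A = B →
          ∀ (nJ β : ℝ), 0 ≤ nJ → 0 ≤ β →
            (∀ b, |J b| ≤ nJ * ((geomT D).len (blkV1 hN D b) ^ 3)⁻¹) →
            (∀ i, |B i| ≤ β * (((ℓ : ℝ) + 1) ^ (i.1.1 : ℕ))⁻¹) →
            ∀ b : PBond (PV d ℓ m K hd hL) 0,
              |A b| ≤ B₀ * (1 + 2 * a₁) * (nJ + β) * ((geomT D).len (blkV1 hN D b))⁻¹ := by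
  obtain ⟨B₀, N₁, hB₀, hN₁, h⟩ := ineq159_A_member_V1 d ℓ hC hσ 3
  refine ⟨B₀, N₁, hB₀, hN₁, ?_⟩
  intro k Mh R hMh1 hRM1 P' hP D m K hd hL hN hk cf hcf w hw a₁ ha₁ hwin hG A J B h55 h42 h56 nJ β hnJ hβ hJ hB b
  -- the source `X = J + Q*aB` of (1.58) in the `(−3)`-weight, with the second summand inserted by §3
  have hS : 0 ≤ (1 + 2 * a₁) * (nJ + β) := by positivity
  have hX : ∀ b' : PBond (PV d ℓ m K hd hL) 0,
      |(J + QsE (domT hN D hk) (aE (domT hN D hk) w B)) b'| ≤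
        (1 + 2 * a₁) * (nJ + β) * ((geomT D).len (blkV1 hN D b') ^ 3)⁻¹ := by
    intro b'
    have h2 := abs_QsE_aE_le hN D hk ha₁ hβ w B hwin hB b'
    have hl0 : 0 ≤ ((geomT D).len (blkV1 hN D b') ^ 3)⁻¹ := inv_nonneg.2 (pow_nonneg (lenT_pos D _).le 3)
    have hadd : (J + QsE (domT hN D hk) (aE (domT hN D hk) w B)) b' =
        J b' + (QsE (domT hN D hk) (aE (domT hN D hk) w B)) b' := rfl
    rw [hadd]
    refine (abs_add_le _ _).trans ?_
    have := hJ b'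
    nlinarith [mul_nonneg ha₁ hβ, mul_nonneg hnJ hl0, mul_nonneg hβ hl0, mul_nonneg (mul_nonneg ha₁ hnJ) hl0]
  have key := h k Mh R hMh1 hRM1 P' hP D m K hd hL hN hk cf hcf w hw hG A J B h55 h42 h56 ((1 + 2 * a₁) * (nJ + β)) hS hX b
  have hlpos : 0 < (geomT D).len (blkV1 hN D b) := lenT_pos D _
  have hl0 : (geomT D).len (blkV1 hN D b) ≠ 0 := hlpos.ne'
  refine key.trans (le_of_eq ?_)
  field_simp

end Printed

/-! ## §5  PROPOSITION 3 AT U₀ = 1 ON THE `k`-LEVEL TORUS, VECTOR SIDE, MODULO THE THREE (2.136) MAJORANTS OF `G(1)`, `∇G(1)`, `ΔG(1)`: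
(1.59) ⟹ (1.60) ⟹ (1.62) with print's size lines (1.55)/(1.56), the side condition «B₀36dα₂ ≦ ½» and (1.61), via `B8.apriori_160/162` -/

section Prop3

open B8ScaledSupNorm (msup msup_nonneg)
open B8Ineq159MultiLevelTorus (eq158_line2_V1)
open B8Ineq159MultiLevelTorusL0 (ineq159_multiLevelTorus_V1 msup_le_of_pointwise_blk pointwise_of_msup_le_blk)

/-- **PROPOSITION 3 (p. 87) AT U₀ = 1 ON THE `k`-LEVEL V1 TORUS FOR THE GENUINE MULTI-LEVEL `G(1) = Δ_a⁻¹`, MODULO THE [B6] PROP. 2.6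
MAJORANTS** («If U₀, U₁, U₂ satisfy (1.40)–(1.42) with α₀, α₁, α₂ bounded by a constant depending on d and L only, and α₂ satisfies the
additional restriction (1.61), then U₁ satisfies (1.36)–(1.39) with B₁ = 5dLB₀, B₂(β₀) = 5dLB₀(β₀), where B₀, B₀(β₀) are the corresponding norms
of the operators G(U₀), H(U₀), and depend on d and L only»), the four sup-norm members, in print's weighted norms `B8ScaledSupNorm.msup`:
for all `C, σ > 0` there are `B₀ ≥ 1`, `N₁ ≥ 1` (functions of `d, ℓ, C, σ`) such that on every admissible torus datum, for every `c′ ≠ 0`,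
weights `w > 0` in the window `|w| ≦ a₁(Lʲ)^{d+1}(Lʲ)⁻²`, flat first/second-order operators `Dop ν` (the components of `∇^η_{U₀}` at `U₀ = 1`)
and `Lop` (`Δ^η_{U₀}` at `U₀ = 1`) — ARBITRARY linear maps on the vector fields —, IF `onFun G(1)`, `Dop ν ∘ onFun G(1)`, `Lop ∘ onFun G(1)`
carry the (2.136) majorants with prefactors `(Lʲ)²`, `Lʲ`, `1` on `blkV1 hN D`, THEN for every `A` with (1.55) `∂*∂A = J`, (1.42) `R∂*A = 0`,
(1.56) `QA = B`, sizes `|J(b)| ≦ n_J(L^{j(b)})⁻³` («|J|₍₋₃₎ = n_J»), `|B_{(j,c)}| ≦ n_B(Lʲ)⁻¹` («|B₁| ≦ n_B»), and print's real constants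
`d_P ≥ 0`, `L_P` with `d_PL_P ≥ 1`, `α₀, α₁, α₂ ≥ 0`, `C₂` subject to the size lines (1.55) «|J|₍₋₃₎ ≦ 2α₀ + 36dα₂|∇A|₍₋₂₎ + 50dα₂³ + 10dα₀α₂»,
(1.56) «|B₁| < 2dLα₁ + C₂α₂²», p. 86 «B₀36dα₂ ≦ ½» (+ `50dα₂ ≤ 1`) and (1.61): with `B₀′ := B₀(1 + 2a₁)`,
**`|A|₍₋₁₎, |∇A|₍₋₂₎, |J|₍₋₃₎ (= |D*DA|₍₋₃₎), |ΔA|₍₋₃₎ ≦ 5d_PL_PB₀′(α₀ + α₁)`**, and, as printed in (1.62) «on Ω_j», pointwise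
`|A(b)| ≦ 5d_PL_PB₀′(α₀ + α₁)(L^{j(b)})⁻¹`, `|(Dop ν A)(b)| ≦ …(L^{j(b)})⁻²`, `|(Lop A)(b)| ≦ …(L^{j(b)})⁻³` at every fine bond — (1.62) with `B₁ = 5dLB₀′`.
[cite: Balaban1985RegularSpaces, Prop. 3 p.87, (1.59)–(1.62) pp.86–87, (1.55)–(1.58) p.86; Balaban1985BackgroundPropagators, Theorem 3.3 p.399, (3.47) p.398; Balaban1984PropagatorsII, Prop. 2.6 (2.136) p.247, (2.19) p.226] -/
theorem prop3_multiLevelTorus_V1 (d ℓ : ℕ) {C σ : ℝ} (hC : 0 < C) (hσ : 0 < σ) :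
    ∃ B₀ : ℝ, ∃ N₁ : ℕ, 1 ≤ B₀ ∧ 0 < N₁ ∧
      ∀ (k Mh R : ℕ), 1 ≤ Mh → N₁ + 1 ≤ R * ((ℓ + 1) * Mh) →
      ∀ (P' : Fin (d + 1) → ℕ) (_hP : ∀ μ, 1 ≤ P' μ) (D : B6MultiLevelTorusOperatorL0.TDomains d ℓ Mh k P' R)
        (m K : ℕ) (hd : 1 ≤ d + 1) (hL : Odd (ℓ + 1) ∧ 1 < ℓ + 1)
        (hN : ∀ μ, N0 ℓ Mh k P' μ = (PV d ℓ m K hd hL).sitesPerDir 0) (hk : k ≤ m + K)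
        (cf : ℝ) (hcf : cf ≠ 0) (w : BondIdx (domT hN D hk) → ℝ) (hw : ∀ i, 0 < w i) (a₁ : ℝ) (_ha₁ : 0 ≤ a₁)
        (_hwin : ∀ i, |w i| ≤ a₁ * (((ℓ : ℝ) + 1) ^ (d + 1)) ^ (i.1.1 : ℕ) * ((((ℓ : ℝ) + 1) ^ (i.1.1 : ℕ)) ^ 2)⁻¹)
        (Dop : Fin (d + 1) → Module.End ℝ (PBond (PV d ℓ m K hd hL) 0 → ℝ))
        (Lop : Module.End ℝ (PBond (PV d ℓ m K hd hL) 0 → ℝ)),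
        HasMajorant (g := geomT D) (blkV1 hN D) (onFun (GE (domT hN D hk) hcf hw))
          (fun y y' => C * (geomT D).len y ^ 2 * Real.exp (-(σ * (geomT D).dist y y'))) →
        (∀ ν, HasMajorant (g := geomT D) (blkV1 hN D) (Dop ν ∘ₗ onFun (GE (domT hN D hk) hcf hw))
          (fun y y' => C * (geomT D).len y * Real.exp (-(σ * (geomT D).dist y y')))) →
        HasMajorant (g := geomT D) (blkV1 hN D) (Lop ∘ₗ onFun (GE (domT hN D hk) hcf hw))
          (fun y y' => C * Real.exp (-(σ * (geomT D).dist y y'))) →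
        ∀ (A J : BondSpace (PV d ℓ m K hd hL)) (B : BondIdxSpace (domT hN D hk)),
          dcsE cf (dcE cf A) = J → RE (domT hN D hk) cf (dsE cf A) = 0 → QE (domT hN D hk) A = B →
          ∀ (nJ nB : ℝ), 0 ≤ nJ → 0 ≤ nB →
            (∀ b, |J b| ≤ nJ * ((geomT D).len (blkV1 hN D b) ^ 3)⁻¹) →
            (∀ i, |B i| ≤ nB * (((ℓ : ℝ) + 1) ^ (i.1.1 : ℕ))⁻¹) →
          ∀ (dP LP C₂ α₀ α₁ α₂ : ℝ), 0 ≤ dP → 1 ≤ dP * LP → 0 ≤ α₀ → 0 ≤ α₁ → 0 ≤ α₂ →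
            nJ ≤ 2 * α₀ + 36 * dP * α₂ *
                msup (ℓ + 1) k 1 (-2) (fun j (p : Fin (d + 1) × PBond (PV d ℓ m K hd hL) 0) => j ≤ (blkV1 hN D p.2).1.1)
                  (fun p : Fin (d + 1) × PBond (PV d ℓ m K hd hL) 0 => Dop p.1 (WithLp.ofLp A) p.2) +
              50 * dP * α₂ ^ 3 + 10 * dP * α₀ * α₂ →
            nB ≤ 2 * dP * LP * α₁ + C₂ * α₂ ^ 2 →
            36 * dP * (B₀ * (1 + 2 * a₁)) * α₂ ≤ 1 / 2 → 50 * dP * α₂ ≤ 1 →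
            2 * α₂ ^ 2 + 20 * dP * α₀ * α₂ + 2 * C₂ * α₂ ^ 2 ≤ α₀ + α₁ →
            msup (ℓ + 1) k 1 (-1) (fun j (b : PBond (PV d ℓ m K hd hL) 0) => j ≤ (blkV1 hN D b).1.1) (WithLp.ofLp A) ≤
                5 * dP * LP * (B₀ * (1 + 2 * a₁)) * (α₀ + α₁) ∧
              msup (ℓ + 1) k 1 (-2) (fun j (p : Fin (d + 1) × PBond (PV d ℓ m K hd hL) 0) => j ≤ (blkV1 hN D p.2).1.1)
                  (fun p : Fin (d + 1) × PBond (PV d ℓ m K hd hL) 0 => Dop p.1 (WithLp.ofLp A) p.2) ≤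
                5 * dP * LP * (B₀ * (1 + 2 * a₁)) * (α₀ + α₁) ∧
              nJ ≤ 5 * dP * LP * (B₀ * (1 + 2 * a₁)) * (α₀ + α₁) ∧
              msup (ℓ + 1) k 1 (-3) (fun j (b : PBond (PV d ℓ m K hd hL) 0) => j ≤ (blkV1 hN D b).1.1) (Lop (WithLp.ofLp A)) ≤
                5 * dP * LP * (B₀ * (1 + 2 * a₁)) * (α₀ + α₁) ∧
              -- (1.62) as printed, «on Ω_j»: the pointwise forms at every fine bond read at its own level
              (∀ b : PBond (PV d ℓ m K hd hL) 0,
                |WithLp.ofLp A b| ≤ 5 * dP * LP * (B₀ * (1 + 2 * a₁)) * (α₀ + α₁) * ((geomT D).len (blkV1 hN D b) ^ 1)⁻¹) ∧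
              (∀ (ν : Fin (d + 1)) (b : PBond (PV d ℓ m K hd hL) 0),
                |Dop ν (WithLp.ofLp A) b| ≤ 5 * dP * LP * (B₀ * (1 + 2 * a₁)) * (α₀ + α₁) * ((geomT D).len (blkV1 hN D b) ^ 2)⁻¹) ∧
              (∀ b : PBond (PV d ℓ m K hd hL) 0,
                |Lop (WithLp.ofLp A) b| ≤ 5 * dP * LP * (B₀ * (1 + 2 * a₁)) * (α₀ + α₁) * ((geomT D).len (blkV1 hN D b) ^ 3)⁻¹) := by
  obtain ⟨B₀, N₁, hB₀, hN₁, h⟩ := ineq159_multiLevelTorus_V1 d ℓ hC hσ 3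
  refine ⟨B₀ + 1, N₁, by linarith, hN₁, ?_⟩
  intro k Mh R hMh1 hRM1 P' hP D m K hd hL hN hk cf hcf w hw a₁ ha₁ hwin Dop Lop hG hD hLap A J B h55 h42 h56 nJ nB hnJ hnB hJ hB
    dP LP C₂ α₀ α₁ α₂ hdP hdL hα₀ hα₁ hα₂ h55s h56s hside h50 h61
  -- (1.58) line 2 for the genuine operator, and the size of its source in the (−3)-weight (§3)
  have hA := eq158_line2_V1 (domT hN D hk) hcf hw A J B h55 h42 h56
  have hS : 0 ≤ (1 + 2 * a₁) * (nJ + nB) := by positivity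
  have hX : ∀ b' : PBond (PV d ℓ m K hd hL) 0,
      |(WithLp.ofLp (J + QsE (domT hN D hk) (aE (domT hN D hk) w B))) b'| ≤
        (1 + 2 * a₁) * (nJ + nB) * ((geomT D).len (blkV1 hN D b') ^ 3)⁻¹ := by
    intro b'
    have h2 := abs_QsE_aE_le hN D hk ha₁ hnB w B hwin hB b'
    have hl0 : 0 ≤ ((geomT D).len (blkV1 hN D b') ^ 3)⁻¹ := inv_nonneg.2 (pow_nonneg (lenT_pos D _).le 3)
    have hadd : (WithLp.ofLp (J + QsE (domT hN D hk) (aE (domT hN D hk) w B))) b' =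
        J b' + (QsE (domT hN D hk) (aE (domT hN D hk) w B)) b' := rfl
    rw [hadd]
    refine (abs_add_le _ _).trans ?_
    have := hJ b'
    nlinarith [mul_nonneg ha₁ hnB, mul_nonneg hnJ hl0, mul_nonneg hnB hl0, mul_nonneg (mul_nonneg ha₁ hnJ) hl0]
  -- the three operator bounds of `B8Ineq159MultiLevelTorus` §3 with `Gv := onFun G(1)`, `DGv ν := Dop ν ∘ onFun G(1)`, `LGv := Lop ∘ onFun G(1)`
  have key := h k Mh R hMh1 hRM1 P' hP D m K hd hL hN (onFun (GE (domT hN D hk) hcf hw))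
    (Lop ∘ₗ onFun (GE (domT hN D hk) hcf hw)) (fun ν => Dop ν ∘ₗ onFun (GE (domT hN D hk) hcf hw)) hG hD hLap
    (WithLp.ofLp (J + QsE (domT hN D hk) (aE (domT hN D hk) w B))) _ hS hX
  -- `A = G(1)X` read on functions
  have hAfun : WithLp.ofLp A = onFun (GE (domT hN D hk) hcf hw) (WithLp.ofLp (J + QsE (domT hN D hk) (aE (domT hN D hk) w B))) := by
    funext b
    rw [onFun_apply, WithLp.toLp_ofLp, ← hA]
  -- the constant of this file
  have hBp1 : 1 ≤ (B₀ + 1) * (1 + 2 * a₁) := by nlinarith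
  have hBp0 : 0 ≤ (B₀ + 1) * (1 + 2 * a₁) := by linarith
  have hlen0 : ∀ b : PBond (PV d ℓ m K hd hL) 0, 0 < (geomT D).len (blkV1 hN D b) := fun b => lenT_pos D _
  -- the weakening `B₀ ≤ B₀ + 1` against a non-negative product
  have hweak : ∀ {q v : ℝ}, 0 ≤ q → v ≤ B₀ * q * ((1 + 2 * a₁) * (nJ + nB)) →
      v ≤ (B₀ + 1) * (1 + 2 * a₁) * (nJ + nB) * q := by
    intro q v hq hv
    refine hv.trans ?_
    have h0 : 0 ≤ q * ((1 + 2 * a₁) * (nJ + nB)) := mul_nonneg hq hS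
    nlinarith
  -- member `|A|₍₋₁₎`
  have mA : ∀ b : PBond (PV d ℓ m K hd hL) 0,
      |WithLp.ofLp A b| ≤ (B₀ + 1) * (1 + 2 * a₁) * (nJ + nB) * ((geomT D).len (blkV1 hN D b) ^ 1)⁻¹ := by
    intro b
    have h1 := (key b).1
    rw [← hAfun] at h1
    have hq : 0 ≤ ((geomT D).len (blkV1 hN D b) ^ 1)⁻¹ := inv_nonneg.2 (pow_nonneg (hlen0 b).le 1)
    refine hweak hq (h1.trans (le_of_eq ?_))
    have hl : (geomT D).len (blkV1 hN D b) ≠ 0 := (hlen0 b).ne'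
    field_simp
  -- member `|∇A|₍₋₂₎` (every component)
  have mD : ∀ p : Fin (d + 1) × PBond (PV d ℓ m K hd hL) 0,
      |Dop p.1 (WithLp.ofLp A) p.2| ≤ (B₀ + 1) * (1 + 2 * a₁) * (nJ + nB) * ((geomT D).len (blkV1 hN D p.2) ^ 2)⁻¹ := by
    intro p
    have h1 := (key p.2).2.1 p.1
    rw [LinearMap.comp_apply, ← hAfun] at h1
    have hq : 0 ≤ ((geomT D).len (blkV1 hN D p.2) ^ 2)⁻¹ := inv_nonneg.2 (pow_nonneg (hlen0 p.2).le 2)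
    refine hweak hq (h1.trans (le_of_eq ?_))
    have hl : (geomT D).len (blkV1 hN D p.2) ≠ 0 := (hlen0 p.2).ne'
    field_simp
  -- member `|ΔA|₍₋₃₎`
  have mL : ∀ b : PBond (PV d ℓ m K hd hL) 0,
      |Lop (WithLp.ofLp A) b| ≤ (B₀ + 1) * (1 + 2 * a₁) * (nJ + nB) * ((geomT D).len (blkV1 hN D b) ^ 3)⁻¹ := by
    intro b
    have h1 := (key b).2.2
    rw [LinearMap.comp_apply, ← hAfun] at h1
    have hq : 0 ≤ ((geomT D).len (blkV1 hN D b) ^ 3)⁻¹ := inv_nonneg.2 (pow_nonneg (hlen0 b).le 3)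
    exact hweak hq (h1.trans (le_of_eq (by ring)))
  -- (1.59) as norm inequalities
  have e3 : (-3 : ℝ) = -((3 : ℕ) : ℝ) := by norm_num
  have e2 : (-2 : ℝ) = -((2 : ℕ) : ℝ) := by norm_num
  have e1 : (-1 : ℝ) = -((1 : ℕ) : ℝ) := by norm_num
  have hBS : 0 ≤ (B₀ + 1) * (1 + 2 * a₁) * (nJ + nB) := by positivity
  have h59a : msup (ℓ + 1) k 1 (-1) (fun j (b : PBond (PV d ℓ m K hd hL) 0) => j ≤ (blkV1 hN D b).1.1) (WithLp.ofLp A) ≤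
      (B₀ + 1) * (1 + 2 * a₁) * (nJ + nB) := by
    rw [e1]; exact msup_le_of_pointwise_blk D (blkV1 hN D) 1 hBS mA
  have h59g : msup (ℓ + 1) k 1 (-2) (fun j (p : Fin (d + 1) × PBond (PV d ℓ m K hd hL) 0) => j ≤ (blkV1 hN D p.2).1.1)
      (fun p : Fin (d + 1) × PBond (PV d ℓ m K hd hL) 0 => Dop p.1 (WithLp.ofLp A) p.2) ≤ (B₀ + 1) * (1 + 2 * a₁) * (nJ + nB) := by
    rw [e2]; exact msup_le_of_pointwise_blk D (fun p : Fin (d + 1) × PBond (PV d ℓ m K hd hL) 0 => blkV1 hN D p.2) 2 hBS mD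
  have h59l : msup (ℓ + 1) k 1 (-3) (fun j (b : PBond (PV d ℓ m K hd hL) 0) => j ≤ (blkV1 hN D b).1.1) (Lop (WithLp.ofLp A)) ≤
      (B₀ + 1) * (1 + 2 * a₁) * (nJ + nB) := by
    rw [e3]; exact msup_le_of_pointwise_blk D (blkV1 hN D) 3 hBS mL
  have h59j : nJ ≤ (B₀ + 1) * (1 + 2 * a₁) * (nJ + nB) := by nlinarith
  have hg0 : 0 ≤ msup (ℓ + 1) k 1 (-2) (fun j (p : Fin (d + 1) × PBond (PV d ℓ m K hd hL) 0) => j ≤ (blkV1 hN D p.2).1.1)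
      (fun p : Fin (d + 1) × PBond (PV d ℓ m K hd hL) 0 => Dop p.1 (WithLp.ofLp A) p.2) := msup_nonneg _ _ zero_le_one _ _ _
  -- (1.60) and (1.62) by the kernel-checked a-priori algebra of `B8`
  obtain ⟨c1, c2, c3, c4⟩ := B8.apriori_160 (d := dP) (L := LP) (C₂ := C₂) hdP hBp0 hα₂ hg0 h55s h56s h59a h59g h59j h59l
    hside h50
  have h162 := B8.apriori_162 (C₂ := C₂) hBp0 hdL hα₀ hα₁ h61
  have f1 := c1.trans h162
  have f2 := c2.trans h162
  have f4 := c4.trans h162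
  refine ⟨f1, f2, c3.trans h162, f4, fun b => ?_, fun ν b => ?_, fun b => ?_⟩
  · rw [e1] at f1
    exact pointwise_of_msup_le_blk D (blkV1 hN D) 1 f1 b
  · rw [e2] at f2
    exact pointwise_of_msup_le_blk D (fun p : Fin (d + 1) × PBond (PV d ℓ m K hd hL) 0 => blkV1 hN D p.2) 2 f2 (ν, b)
  · rw [e3] at f4
    exact pointwise_of_msup_le_blk D (blkV1 hN D) 3 f4 b

end Prop3

end

end Literature.MathematicalPhysics.QuantumFieldTheory.Balaban1983to89.B8Prop3MultiLevelTorusL0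

-- L0-port marker: J7 call sites rewritten
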